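import Summits.RiemannHypothesis.RiemannHypothesis.Theorems.SemilocalDeletionAnimalCombs
import HarnessLib

/-!
# PRODUCT COMBS: deleting several primes costs EXACTLY the sum of the one-prime comb values

`SemilocalDeletionPairCombs.lean` (p379698) showed with two-dimensional ALTERNATING combs (amplitudes `(−1)^{i+j}`) that the deletion
costs of two primes ADD with no interaction term.  Here: ANY finite set `T` of primes and ANY real amplitude vectors
`X_p = (X_p(0), …, X_p(m_p))`, `p ∈ T`.  The PRODUCT COMB has one tooth `h(· − x_k)` at every point
`x_k = Σ_{p∈T} k_p·log p − C` of the box `0 ≤ k_p ≤ m_p` (`C = Σ_p m_p log p/2` centres it), with amplitude `a_k = Π_p X_p(k_p)`.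
By unique factorisation (§1, `eq_update_of_sum_log_eq`) the only pair of teeth at distance `e·log p₀` is `k = k' + e·δ_{p₀}`, so the
lag sums of the configuration FACTORISE (§2, `lag_sum_eq`):

  `Σ_{k,k'} [x_k − x_{k'} = e·log p₀]·2a_k a_{k'} = 2·(Σ_i X_{p₀}(i+e)X_{p₀}(i)) · Π_{p≠p₀} |X_p|²`.

With the comb autocorrelation of `SemilocalDeletionAnimalCombs` and the one-prime all-powers identity of `SemilocalDeletionToeplitzFloor`
(§3), for teeth `δ`-separated from the lags (`h ∈ C(δ)`; every difference `x_k − x_{k'} − e·log p` is `0` or `> 2δ` in modulus —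
true for all small `δ` since the finitely many nonzero differences are bounded away from `0`, cf. `SemilocalDeletionPairCombsExist`):

* `weilSemilocalQuadratic_erase_sub_prodComb`: `Q_{S'∖p₀}(g) − Q_{S'}(g) = ‖h‖₂²·[XᵀA(p₀)X]_{p₀}·Π_{p≠p₀}|X_p|²` for every `S' ∋ p₀`,
  where `[XᵀA(p₀)X]_{p₀} = 2Σ_{d<E}(log p₀/√(p₀^{d+1}))Σ_i X_{p₀}(i+d+1)X_{p₀}(i)` is the one-prime zero-diagonal Toeplitz form
  (terms `d ≥ m_{p₀}` vanish);
* `weilSemilocalQuadratic_sdiff_sub_prodComb` (★ EXACT ADDITIVITY): `Q_{S∖T}(g) − Q_S(g) = ‖h‖₂²·Σ_{p₀∈T} [XᵀA(p₀)X]_{p₀}·Π_{p≠p₀}|X_p|²`;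
* `integral_norm_sq_prodComb`: `‖g‖₂² = ‖h‖₂²·Π_p |X_p|²`;  `semilocalGroundEnergy_sdiff_mul_le_prodComb` (★ Rayleigh):
  `λ_min(S∖T; C+δ) ≤ Re Q_S(g)/‖g‖₂² + Σ_{p∈T} [XᵀA(p)X]_p/|X_p|²` — the joint deletion floor is at most the undeleted comb energy plus
  the SUM of the one-prime Rayleigh quotients.

With the band-edge combs of `SemilocalDeletionToeplitzBandEdgeCombs` (quotient `−F̌_p(m_p)`, `F_p − F̌_p(m) ≍ (log p)·m⁻²`) the JOINT lag
floor `μ*_T(b)` of HOME/cc-s2-1/gen17/ANIMAL-SUPREMUM.md obeys `Σ_p F̌_p(m_p) ≤ μ*_T(b) ≤ Σ_p F̂_p(⌊2b/log p⌋) < Σ_p F_p` (`Σ m_p log p = 2b`):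
the floor-level interaction is at most the sum of the single-prime band-edge gaps, `O(b⁻²)` (§9 there: `I₂^floor(2,3)` `2.6e−2 → 4e−4`,
`b = 1 → 6`) — at the level of lag kinematics deletion costs are ASYMPTOTICALLY ADDITIVE for every finite set of primes.
Nothing here bears on RH; these are statements about truncated Weil forms.
-/

set_option linter.dupNamespace false

noncomputable section

open Complex Filter Set MeasureTheory
open scoped Real Topology ComplexConjugate

namespace Summit.RiemannHypothesis.RiemannHypothesis.Theorems.SemilocalDeletionProductCombs

open Literature.NumberTheory.LFunctions
open Summit.RiemannHypothesis.RiemannHypothesis.Theorems.SemilocalDeletionAnimalCombs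
open Summit.RiemannHypothesis.RiemannHypothesis.Theorems.SemilocalDeletionToeplitzFloor
open Summit.RiemannHypothesis.RiemannHypothesis.Theorems.HandoffSemilocalEnergy

/-! ## §1  The lattice of a finite set of primes: `Σ_p k_p log p` determines `k` -/

variable {T : Finset ℕ}

/-- `exp(Σ_{p∈T} k_p·log p) = Π_{p∈T} p^{k_p}` for a set `T` of positive integers. -/
theorem exp_sum_mul_log (hT : ∀ p ∈ T, 0 < p) (k : T → ℕ) :
    Real.exp (∑ p : T, (k p : ℝ) * Real.log (p : ℕ)) = ((∏ p : T, (p : ℕ) ^ k p : ℕ) : ℝ) := by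
  rw [Real.exp_sum]
  push_cast
  refine Finset.prod_congr rfl fun p _ ↦ ?_
  rw [Real.exp_nat_mul, Real.exp_log (by exact_mod_cast hT p p.2)]

/-- The exponent of `q ∈ T` in `Π_{p∈T} p^{k_p}` is `k_q` (distinct primes). -/
theorem factorization_prod_pow (hT : ∀ p ∈ T, p.Prime) (k : T → ℕ) (q : T) :
    (∏ p : T, (p : ℕ) ^ k p).factorization (q : ℕ) = k q := by
  classical
  rw [Nat.factorization_prod fun (p : T) _ ↦ pow_ne_zero _ (hT p p.2).ne_zero, Finset.sum_apply']
  simp_rw [Nat.Prime.factorization_pow (hT _ (Subtype.mem _)), Finsupp.single_apply]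
  rw [Finset.sum_eq_single q]
  · simp
  · intro p _ hpq
    exact if_neg fun h ↦ hpq (Subtype.ext h)
  · intro h; exact absurd (Finset.mem_univ q) h

/-- **Log-independence:** `Σ_p k_p log p = Σ_p k'_p log p + e·log p₀` (`p₀ ∈ T`, distinct primes) forces `k = update k' p₀ (k'_{p₀} + e)`. -/
theorem eq_update_of_sum_log_eq (hT : ∀ p ∈ T, p.Prime) (k k' : T → ℕ) (p₀ : T) (e : ℕ)
    (h : ∑ p : T, (k p : ℝ) * Real.log (p : ℕ) = ∑ p : T, (k' p : ℝ) * Real.log (p : ℕ) + e * Real.log (p₀ : ℕ)) :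
    k = Function.update k' p₀ (k' p₀ + e) := by
  classical
  have hT0 : ∀ p ∈ T, 0 < p := fun p hp ↦ (hT p hp).pos
  have hp0 : (0 : ℝ) < (p₀ : ℕ) := by exact_mod_cast hT0 p₀ p₀.2
  have hexp : ((∏ p : T, (p : ℕ) ^ k p : ℕ) : ℝ) = ((∏ p : T, (p : ℕ) ^ k' p : ℕ) : ℝ) * ((p₀ : ℕ) : ℝ) ^ e := by
    rw [← exp_sum_mul_log hT0 k, h, Real.exp_add, exp_sum_mul_log hT0 k', Real.exp_nat_mul, Real.exp_log hp0]
  have hnat : (∏ p : T, (p : ℕ) ^ k p) = (∏ p : T, (p : ℕ) ^ k' p) * (p₀ : ℕ) ^ e := by exact_mod_cast hexp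
  funext q
  have hq : (∏ p : T, (p : ℕ) ^ k p).factorization (q : ℕ) = ((∏ p : T, (p : ℕ) ^ k' p) * (p₀ : ℕ) ^ e).factorization (q : ℕ) := by
    rw [hnat]
  rw [Nat.factorization_mul (Finset.prod_ne_zero_iff.2 fun (p : T) _ ↦ pow_ne_zero _ (hT p p.2).ne_zero)
    (pow_ne_zero _ (hT p₀ p₀.2).ne_zero), Finsupp.add_apply, factorization_prod_pow hT k q,
    factorization_prod_pow hT k' q, Nat.Prime.factorization_pow (hT p₀ p₀.2), Finsupp.single_apply] at hq
  by_cases hqp : q = p₀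
  · subst hqp; rw [Function.update_self]; simpa using hq
  · rw [Function.update_of_ne hqp]; rw [if_neg fun h' ↦ hqp (Subtype.ext h'.symm)] at hq; simpa using hq

/-- Positions of the product comb: `pos k = Σ_p k_p log p`; `pos (update k p₀ (k_{p₀} + e)) = pos k + e·log p₀`. -/
theorem sum_update_mul_log (k : T → ℕ) (p₀ : T) (e : ℕ) :
    ∑ p : T, ((Function.update k p₀ (k p₀ + e) p : ℕ) : ℝ) * Real.log (p : ℕ) =
      ∑ p : T, (k p : ℝ) * Real.log (p : ℕ) + e * Real.log (p₀ : ℕ) := by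
  classical
  have h1 : ∀ p : T, ((Function.update k p₀ (k p₀ + e) p : ℕ) : ℝ) * Real.log (p : ℕ) =
      (k p : ℝ) * Real.log (p : ℕ) + (if p = p₀ then (e : ℝ) * Real.log (p₀ : ℕ) else 0) := by
    intro p
    by_cases hp : p = p₀
    · subst hp; rw [Function.update_self, if_pos rfl]; push_cast; ring
    · rw [Function.update_of_ne hp, if_neg hp, add_zero]
  rw [Finset.sum_congr rfl fun p _ ↦ h1 p, Finset.sum_add_distrib, Finset.sum_ite_eq' Finset.univ p₀]
  simp

/-- Positions are DISTINCT for distinct exponent vectors and lie in `[0, Σ_p m_p log p]` on the box `k_p ≤ m_p`. -/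
theorem sum_mul_log_mem_Icc (hT : ∀ p ∈ T, p.Prime) {m : ℕ → ℕ} {k : T → ℕ}
    (hk : k ∈ Fintype.piFinset fun p : T ↦ Finset.range (m p + 1)) :
    ∑ p : T, (k p : ℝ) * Real.log (p : ℕ) ∈ Icc 0 (∑ p : T, (m p : ℝ) * Real.log (p : ℕ)) := by
  rw [Fintype.mem_piFinset] at hk
  have hlog : ∀ p : T, 0 ≤ Real.log (p : ℕ) := fun p ↦ Real.log_nonneg (by exact_mod_cast (hT p p.2).one_lt.le)
  refine ⟨Finset.sum_nonneg fun p _ ↦ mul_nonneg (Nat.cast_nonneg _) (hlog p), Finset.sum_le_sum fun p _ ↦ ?_⟩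
  exact mul_le_mul_of_nonneg_right (by exact_mod_cast Nat.lt_succ_iff.mp (Finset.mem_range.mp (hk p))) (hlog p)


/-! ## §2  Product amplitudes: the lag sums of the product configuration factorise -/

variable {m : ℕ → ℕ} {X : ℕ → ℕ → ℝ} {C : ℝ} {x : (T → ℕ) → ℝ} {a : (T → ℕ) → ℂ}

/-- Membership in the box `k_p ≤ m_p`. -/
theorem mem_box_iff {k : T → ℕ} : k ∈ Fintype.piFinset (fun p : T ↦ Finset.range (m p + 1)) ↔ ∀ p : T, k p ≤ m p := by
  rw [Fintype.mem_piFinset]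
  exact forall_congr' fun p ↦ by rw [Finset.mem_range, Nat.lt_succ_iff]

/-- **One lag, one partner:** the only tooth at distance `e·log p₀` to the right of `k'` is `update k' p₀ (k'_{p₀} + e)`, present iff
`k'_{p₀} + e ≤ m_{p₀}`: `Σ_{k ∈ box} [x_k − x_{k'} = e·log p₀]·F(k) = [k'_{p₀} + e ≤ m_{p₀}]·F(update k' p₀ (k'_{p₀} + e))`. -/
theorem sum_ite_lag_eq (hT : ∀ p ∈ T, p.Prime) (hx : ∀ k, x k = ∑ p : T, (k p : ℝ) * Real.log (p : ℕ) - C)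
    (p₀ : T) (e : ℕ) {k' : T → ℕ} (hk' : k' ∈ Fintype.piFinset (fun p : T ↦ Finset.range (m p + 1))) (F : (T → ℕ) → ℂ) :
    ∑ k ∈ Fintype.piFinset (fun p : T ↦ Finset.range (m p + 1)), (if x k - x k' = e * Real.log (p₀ : ℕ) then F k else 0) =
      if k' p₀ + e ≤ m p₀ then F (Function.update k' p₀ (k' p₀ + e)) else 0 := by
  classical
  set u := Function.update k' p₀ (k' p₀ + e) with hu
  have hiff : ∀ k : T → ℕ, x k - x k' = e * Real.log (p₀ : ℕ) ↔ k = u := by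
    intro k
    rw [hx k, hx k']
    constructor
    · intro hk
      exact eq_update_of_sum_log_eq hT k k' p₀ e (by linarith)
    · rintro rfl
      rw [hu, sum_update_mul_log]; ring
  simp_rw [hiff]
  rw [Finset.sum_ite_eq']
  have hmem : u ∈ Fintype.piFinset (fun p : T ↦ Finset.range (m p + 1)) ↔ k' p₀ + e ≤ m p₀ := by
    rw [mem_box_iff] at hk' ⊢
    constructor
    · intro hu'; simpa [hu] using hu' p₀
    · intro hle p
      by_cases hp : p = p₀
      · subst hp; simpa [hu] using hle
      · rw [hu, Function.update_of_ne hp]; exact hk' p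
  by_cases hle : k' p₀ + e ≤ m p₀
  · rw [if_pos (hmem.2 hle), if_pos hle]
  · rw [if_neg (fun h ↦ hle (hmem.1 h)), if_neg hle]

/-- The product amplitude at a shifted index: `Π_p X_p((update k p₀ v)_p) = X_{p₀}(v)·Π_{p ≠ p₀} X_p(k_p)`. -/
theorem prod_update_eq (k : T → ℕ) (p₀ : T) (v : ℕ) :
    ∏ p : T, X p (Function.update k p₀ v p) = X p₀ v * ∏ p ∈ Finset.univ.erase p₀, X p (k p) := by
  classical
  rw [← Finset.mul_prod_erase Finset.univ _ (Finset.mem_univ p₀), Function.update_self]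
  congr 1
  exact Finset.prod_congr rfl fun p hp ↦ by rw [Function.update_of_ne (Finset.ne_of_mem_erase hp)]

/-- **THE LAG SUMS FACTORISE.** Real product amplitudes `a_k = Π_p X_p(k_p)`, `X_p(i) = 0` for `i > m_p` (`p ∈ T`); for `p₀ ∈ T`, `e : ℕ`:
`Σ_{k,k' ∈ box} [x_k − x_{k'} = e·log p₀]·(a_k ā_{k'} + a_{k'} ā_k) = 2·(Σ_i X_{p₀}(i+e)·X_{p₀}(i)) · Π_{p ≠ p₀} Σ_i X_p(i)²`. -/
theorem lag_sum_eq (hT : ∀ p ∈ T, p.Prime) (hx : ∀ k, x k = ∑ p : T, (k p : ℝ) * Real.log (p : ℕ) - C)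
    (ha : ∀ k, a k = ((∏ p : T, X p (k p) : ℝ) : ℂ)) (hX : ∀ p ∈ T, ∀ i, m p < i → X p i = 0) (p₀ : T) (e : ℕ) :
    ∑ k ∈ Fintype.piFinset (fun p : T ↦ Finset.range (m p + 1)), ∑ k' ∈ Fintype.piFinset (fun p : T ↦ Finset.range (m p + 1)),
        (if x k - x k' = e * Real.log (p₀ : ℕ) then a k * conj (a k') + a k' * conj (a k) else 0) =
      ((2 * (∑ i ∈ Finset.range (m p₀ + 1), X p₀ (i + e) * X p₀ i) *
          ∏ p ∈ Finset.univ.erase p₀, ∑ i ∈ Finset.range (m p + 1), X p i ^ 2 : ℝ) : ℂ) := by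
  classical
  rw [Finset.sum_comm]
  -- inner sum over `k`: one partner
  have hinner : ∀ k' ∈ Fintype.piFinset (fun p : T ↦ Finset.range (m p + 1)),
      ∑ k ∈ Fintype.piFinset (fun p : T ↦ Finset.range (m p + 1)),
          (if x k - x k' = e * Real.log (p₀ : ℕ) then a k * conj (a k') + a k' * conj (a k) else 0) =
        ((2 * ((X p₀ (k' p₀ + e) * X p₀ (k' p₀)) * ∏ p ∈ Finset.univ.erase p₀, X p (k' p) ^ 2) : ℝ) : ℂ) := by
    intro k' hk'
    rw [sum_ite_lag_eq hT hx p₀ e hk', ha, ha, prod_update_eq k' p₀,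
      ← Finset.mul_prod_erase Finset.univ (fun p : T ↦ X p (k' p)) (Finset.mem_univ p₀)]
    by_cases hle : k' p₀ + e ≤ m p₀
    · rw [if_pos hle]
      simp only [Complex.conj_ofReal]
      push_cast
      rw [Finset.prod_pow]
      ring
    · rw [if_neg hle, hX p₀ p₀.2 _ (by omega)]
      push_cast
      ring
  rw [Finset.sum_congr rfl hinner]
  -- sum over `k'` of a product: factorise with `Finset.prod_univ_sum`
  have hG : ∀ k' : T → ℕ, (X p₀ (k' p₀ + e) * X p₀ (k' p₀)) * ∏ p ∈ Finset.univ.erase p₀, X p (k' p) ^ 2 =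
      ∏ p : T, (if p = p₀ then X p (k' p + e) * X p (k' p) else X p (k' p) ^ 2) := by
    intro k'
    rw [← Finset.mul_prod_erase Finset.univ _ (Finset.mem_univ p₀), if_pos rfl]
    congr 1
    exact Finset.prod_congr rfl fun p hp ↦ by rw [if_neg (Finset.ne_of_mem_erase hp)]
  have hsum : ∑ k' ∈ Fintype.piFinset (fun p : T ↦ Finset.range (m p + 1)),
      (X p₀ (k' p₀ + e) * X p₀ (k' p₀)) * ∏ p ∈ Finset.univ.erase p₀, X p (k' p) ^ 2 =
        (∑ i ∈ Finset.range (m p₀ + 1), X p₀ (i + e) * X p₀ i) *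
          ∏ p ∈ Finset.univ.erase p₀, ∑ i ∈ Finset.range (m p + 1), X p i ^ 2 := by
    rw [Finset.sum_congr rfl fun k' _ ↦ hG k',
      ← Finset.prod_univ_sum (fun p : T ↦ Finset.range (m p + 1))
        (fun p i ↦ if p = p₀ then X p (i + e) * X p i else X p i ^ 2),
      ← Finset.mul_prod_erase Finset.univ _ (Finset.mem_univ p₀)]
    congr 1
    · exact Finset.sum_congr rfl fun j _ ↦ if_pos rfl
    · exact Finset.prod_congr rfl fun p hp ↦ Finset.sum_congr rfl fun j _ ↦ if_neg (Finset.ne_of_mem_erase hp)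
  have h2 : ∑ k' ∈ Fintype.piFinset (fun p : T ↦ Finset.range (m p + 1)),
      (((2 * ((X p₀ (k' p₀ + e) * X p₀ (k' p₀)) * ∏ p ∈ Finset.univ.erase p₀, X p (k' p) ^ 2) : ℝ) : ℂ)) =
      (((2 * ∑ k' ∈ Fintype.piFinset (fun p : T ↦ Finset.range (m p + 1)),
        (X p₀ (k' p₀ + e) * X p₀ (k' p₀)) * ∏ p ∈ Finset.univ.erase p₀, X p (k' p) ^ 2 : ℝ) : ℂ)) := by
    push_cast; rw [Finset.mul_sum]
  rw [h2, hsum]; push_cast; ring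


/-! ## §3  The product comb: autocorrelations at the lattice lags, the per-prime cost, and EXACT ADDITIVITY -/

variable {h : ℝ → ℂ} {δ : ℝ}

/-- **Autocorrelation of the product comb at a lattice lag** (teeth `δ`-separated from the lag `e·log p₀`):
`k_g(e·log p₀) + k_g(−e·log p₀) = ‖h‖₂²·2·(Σ_i X_{p₀}(i+e) X_{p₀}(i))·Π_{p ≠ p₀} |X_p|²`. -/
theorem weilConv_weilReflect_prodComb_lag (hh : IsWeilTest h) (hsupp : tsupport h ⊆ Icc (-δ) δ) (hT : ∀ p ∈ T, p.Prime)
    (hx : ∀ k, x k = ∑ p : T, (k p : ℝ) * Real.log (p : ℕ) - C) (ha : ∀ k, a k = ((∏ p : T, X p (k p) : ℝ) : ℂ))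
    (hX : ∀ p ∈ T, ∀ i, m p < i → X p i = 0) (p₀ : T) (e : ℕ)
    (hsep : ∀ k ∈ Fintype.piFinset (fun p : T ↦ Finset.range (m p + 1)), ∀ k' ∈ Fintype.piFinset (fun p : T ↦ Finset.range (m p + 1)),
      x k - x k' ≠ e * Real.log (p₀ : ℕ) → 2 * δ < |x k - x k' - e * Real.log (p₀ : ℕ)|) :
    weilConv (fun t ↦ ∑ k ∈ Fintype.piFinset (fun p : T ↦ Finset.range (m p + 1)), a k * h (t - x k))
        (weilReflect fun t ↦ ∑ k ∈ Fintype.piFinset (fun p : T ↦ Finset.range (m p + 1)), a k * h (t - x k))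
          (e * Real.log (p₀ : ℕ)) +
      weilConv (fun t ↦ ∑ k ∈ Fintype.piFinset (fun p : T ↦ Finset.range (m p + 1)), a k * h (t - x k))
        (weilReflect fun t ↦ ∑ k ∈ Fintype.piFinset (fun p : T ↦ Finset.range (m p + 1)), a k * h (t - x k))
          (-(e * Real.log (p₀ : ℕ))) =
      ((((∫ u : ℝ, ‖h u‖ ^ 2) * ((2 * ∑ i ∈ Finset.range (m p₀ + 1), X p₀ (i + e) * X p₀ i) *
          ∏ p ∈ Finset.univ.erase p₀, ∑ i ∈ Finset.range (m p + 1), X p i ^ 2) : ℝ) : ℂ)) := by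
  rw [weilConv_weilReflect_comb_add_neg hh hsupp fun k hk k' hk' ↦ ?_, lag_sum_eq hT hx ha hX p₀ e]
  · push_cast; ring
  · by_cases hc : x k - x k' = e * Real.log (p₀ : ℕ)
    · exact Or.inl hc
    · exact Or.inr (hsep k hk k' hk' hc)

/-- **PER-PRIME COST of the product comb, exactly.** `p₀ ∈ T ∩ S'`, `C = Σ_p m_p log p/2`, `E` visible powers (`2(C+δ) < (E+1)·log p₀`),
`δ`-separation from the lags `e·log p₀`, `e ≤ E`:  `Q_{S'∖p₀}(g) − Q_{S'}(g) = ‖h‖₂²·[2Σ_{d<E}(log p₀/√(p₀^{d+1}))Σ_i X_{p₀}(i+d+1)X_{p₀}(i)]·Π_{p≠p₀}|X_p|²`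
— the other primes' factors only MULTIPLY the one-prime comb value (cf. `SemilocalDeletionPairCombs.re_erase_comb2`). -/
theorem weilSemilocalQuadratic_erase_sub_prodComb (hh : IsWeilTest h) (hsupp : tsupport h ⊆ Icc (-δ) δ)
    (hT : ∀ p ∈ T, p.Prime) (hx : ∀ k, x k = ∑ p : T, (k p : ℝ) * Real.log (p : ℕ) - C)
    (hC : C = (∑ p : T, (m p : ℝ) * Real.log (p : ℕ)) / 2) (ha : ∀ k, a k = ((∏ p : T, X p (k p) : ℝ) : ℂ))
    (hX : ∀ p ∈ T, ∀ i, m p < i → X p i = 0) (p₀ : T) {E : ℕ} (hE : 2 * (C + δ) < (E + 1) * Real.log (p₀ : ℕ))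
    (hsep : ∀ k ∈ Fintype.piFinset (fun p : T ↦ Finset.range (m p + 1)), ∀ k' ∈ Fintype.piFinset (fun p : T ↦ Finset.range (m p + 1)),
      ∀ e ≤ E, x k - x k' ≠ e * Real.log (p₀ : ℕ) → 2 * δ < |x k - x k' - e * Real.log (p₀ : ℕ)|)
    {S' : Finset ℕ} (hp₀ : (p₀ : ℕ) ∈ S') :
    weilSemilocalQuadratic (S'.erase p₀) (fun t ↦ ∑ k ∈ Fintype.piFinset (fun p : T ↦ Finset.range (m p + 1)), a k * h (t - x k)) -
        weilSemilocalQuadratic S' (fun t ↦ ∑ k ∈ Fintype.piFinset (fun p : T ↦ Finset.range (m p + 1)), a k * h (t - x k)) =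
      ((((∫ u : ℝ, ‖h u‖ ^ 2) *
          ((2 * ∑ d ∈ Finset.range E, Real.log (p₀ : ℕ) / Real.sqrt (((p₀ : ℕ) : ℝ) ^ (d + 1)) *
              ∑ i ∈ Finset.range (m p₀ + 1), X p₀ (i + (d + 1)) * X p₀ i) *
            ∏ p ∈ Finset.univ.erase p₀, ∑ i ∈ Finset.range (m p + 1), X p i ^ 2) : ℝ) : ℂ)) := by
  have hg := isWeilTest_comb hh (Fintype.piFinset (fun p : T ↦ Finset.range (m p + 1))) x a
  have hxC : ∀ k ∈ Fintype.piFinset (fun p : T ↦ Finset.range (m p + 1)), x k ∈ Icc (-(C + δ - δ)) (C + δ - δ) := by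
    intro k hk
    have := sum_mul_log_mem_Icc hT hk
    rw [hx k, mem_Icc] at *
    constructor <;> linarith [this.1, this.2]
  have hgs := tsupport_comb_subset (a := a) hsupp hxC
  have hid := weilSemilocalQuadratic_sub_erase_pow hg (hT p₀ p₀.2) hp₀ hgs hE
  set g := fun t ↦ ∑ k ∈ Fintype.piFinset (fun p : T ↦ Finset.range (m p + 1)), a k * h (t - x k) with hgdef
  have hterm : ∀ d ∈ Finset.range E,
      ((Real.log (p₀ : ℕ) / Real.sqrt (((p₀ : ℕ) : ℝ) ^ (d + 1)) : ℝ) : ℂ) *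
          (weilConv g (weilReflect g) (((d : ℝ) + 1) * Real.log (p₀ : ℕ)) +
            weilConv g (weilReflect g) (-(((d : ℝ) + 1) * Real.log (p₀ : ℕ)))) =
        ((Real.log (p₀ : ℕ) / Real.sqrt (((p₀ : ℕ) : ℝ) ^ (d + 1)) *
            ((∫ u : ℝ, ‖h u‖ ^ 2) * ((2 * ∑ i ∈ Finset.range (m p₀ + 1), X p₀ (i + (d + 1)) * X p₀ i) *
              ∏ p ∈ Finset.univ.erase p₀, ∑ i ∈ Finset.range (m p + 1), X p i ^ 2)) : ℝ) : ℂ) := by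
    intro d hd
    have hl := weilConv_weilReflect_prodComb_lag hh hsupp hT hx ha hX p₀ (d + 1) fun k hk k' hk' hne ↦
      hsep k hk k' hk' (d + 1) (Nat.succ_le_of_lt (Finset.mem_range.mp hd)) hne
    rw [Nat.cast_add, Nat.cast_one] at hl
    rw [hl, ← Complex.ofReal_mul]
  have hR : ∑ d ∈ Finset.range E, Real.log (p₀ : ℕ) / Real.sqrt (((p₀ : ℕ) : ℝ) ^ (d + 1)) *
        ((∫ u : ℝ, ‖h u‖ ^ 2) * ((2 * ∑ i ∈ Finset.range (m p₀ + 1), X p₀ (i + (d + 1)) * X p₀ i) *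
          ∏ p ∈ Finset.univ.erase p₀, ∑ i ∈ Finset.range (m p + 1), X p i ^ 2)) =
      (∫ u : ℝ, ‖h u‖ ^ 2) * ((2 * ∑ d ∈ Finset.range E, Real.log (p₀ : ℕ) / Real.sqrt (((p₀ : ℕ) : ℝ) ^ (d + 1)) *
        ∑ i ∈ Finset.range (m p₀ + 1), X p₀ (i + (d + 1)) * X p₀ i) *
          ∏ p ∈ Finset.univ.erase p₀, ∑ i ∈ Finset.range (m p + 1), X p i ^ 2) := by
    rw [Finset.mul_sum, Finset.sum_mul, Finset.mul_sum]
    exact Finset.sum_congr rfl fun d _ ↦ by ring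
  rw [← hR, Complex.ofReal_sum]
  have hid' : weilSemilocalQuadratic S' g - weilSemilocalQuadratic (S'.erase p₀) g =
      -∑ d ∈ Finset.range E, ((Real.log (p₀ : ℕ) / Real.sqrt (((p₀ : ℕ) : ℝ) ^ (d + 1)) *
            ((∫ u : ℝ, ‖h u‖ ^ 2) * ((2 * ∑ i ∈ Finset.range (m p₀ + 1), X p₀ (i + (d + 1)) * X p₀ i) *
              ∏ p ∈ Finset.univ.erase p₀, ∑ i ∈ Finset.range (m p + 1), X p i ^ 2)) : ℝ) : ℂ) := by
    rw [hid, ← Finset.sum_congr rfl hterm]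
  linear_combination (-1 : ℂ) * hid'

/-- **EXACT ADDITIVITY OF THE PRODUCT COMB.** `T ⊆ S` primes, common visibility bound `E`, `δ`-separation from all lags `e·log p`, `e ≤ E`:
`Q_{S∖T}(g) − Q_S(g) = ‖h‖₂²·Σ_{p₀∈T} [2Σ_{d<E} (log p₀/√(p₀^{d+1}))·Σ_i X_{p₀}(i+d+1)X_{p₀}(i)]·Π_{p≠p₀}|X_p|²` — the SUM of the
one-prime comb values weighted by the other factors' norms: NO INTERACTION TERM, for any number of primes and any amplitudes. -/
theorem weilSemilocalQuadratic_sdiff_sub_prodComb (hh : IsWeilTest h) (hsupp : tsupport h ⊆ Icc (-δ) δ)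
    (hT : ∀ p ∈ T, p.Prime) (hx : ∀ k, x k = ∑ p : T, (k p : ℝ) * Real.log (p : ℕ) - C)
    (hC : C = (∑ p : T, (m p : ℝ) * Real.log (p : ℕ)) / 2) (ha : ∀ k, a k = ((∏ p : T, X p (k p) : ℝ) : ℂ))
    (hX : ∀ p ∈ T, ∀ i, m p < i → X p i = 0) {E : ℕ} (hE : ∀ p : T, 2 * (C + δ) < (E + 1) * Real.log (p : ℕ))
    (hsep : ∀ k ∈ Fintype.piFinset (fun p : T ↦ Finset.range (m p + 1)), ∀ k' ∈ Fintype.piFinset (fun p : T ↦ Finset.range (m p + 1)),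
      ∀ p₀ : T, ∀ e ≤ E, x k - x k' ≠ e * Real.log (p₀ : ℕ) → 2 * δ < |x k - x k' - e * Real.log (p₀ : ℕ)|)
    {S : Finset ℕ} (hTS : T ⊆ S) :
    weilSemilocalQuadratic (S \ T) (fun t ↦ ∑ k ∈ Fintype.piFinset (fun p : T ↦ Finset.range (m p + 1)), a k * h (t - x k)) -
        weilSemilocalQuadratic S (fun t ↦ ∑ k ∈ Fintype.piFinset (fun p : T ↦ Finset.range (m p + 1)), a k * h (t - x k)) =
      ((((∫ u : ℝ, ‖h u‖ ^ 2) * ∑ p₀ : T,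
          ((2 * ∑ d ∈ Finset.range E, Real.log (p₀ : ℕ) / Real.sqrt (((p₀ : ℕ) : ℝ) ^ (d + 1)) *
              ∑ i ∈ Finset.range (m p₀ + 1), X p₀ (i + (d + 1)) * X p₀ i) *
            ∏ p ∈ Finset.univ.erase p₀, ∑ i ∈ Finset.range (m p + 1), X p i ^ 2) : ℝ) : ℂ)) := by
  classical
  set g := fun t ↦ ∑ k ∈ Fintype.piFinset (fun p : T ↦ Finset.range (m p + 1)), a k * h (t - x k) with hgdef
  -- induction over the set `U ⊆ T` of deleted primes (as a finset of the subtype)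
  suffices key : ∀ U : Finset T, weilSemilocalQuadratic (S \ U.map (Function.Embedding.subtype _)) g -
      weilSemilocalQuadratic S g = ((((∫ u : ℝ, ‖h u‖ ^ 2) * ∑ p₀ ∈ U,
          ((2 * ∑ d ∈ Finset.range E, Real.log (p₀ : ℕ) / Real.sqrt (((p₀ : ℕ) : ℝ) ^ (d + 1)) *
              ∑ i ∈ Finset.range (m p₀ + 1), X p₀ (i + (d + 1)) * X p₀ i) *
            ∏ p ∈ Finset.univ.erase p₀, ∑ i ∈ Finset.range (m p + 1), X p i ^ 2) : ℝ) : ℂ)) by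
    have := key Finset.univ
    rwa [Finset.univ_eq_attach, Finset.attach_map_val] at this
  intro U
  induction U using Finset.induction_on with
  | empty => simp
  | @insert p₀ U hp₀U ih =>
    rw [Finset.map_insert, Finset.sdiff_insert, Finset.sum_insert hp₀U]
    have hmem : (p₀ : ℕ) ∈ S \ U.map (Function.Embedding.subtype _) := by
      rw [Finset.mem_sdiff]
      refine ⟨hTS p₀.2, fun hc ↦ hp₀U ?_⟩
      rw [Finset.mem_map] at hc
      obtain ⟨q, hq, hqp⟩ := hc
      rwa [show q = p₀ from Subtype.ext hqp] at hq
    have hstep := weilSemilocalQuadratic_erase_sub_prodComb hh hsupp hT hx hC ha hX p₀ (hE p₀)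
      (fun k hk k' hk' e he hne ↦ hsep k hk k' hk' p₀ e he hne) hmem
    simp only [Function.Embedding.coe_subtype] at hstep ⊢
    push_cast at ih hstep ⊢
    linear_combination hstep + ih

/-! ## §4  Norm and the Rayleigh consequence: the joint cost is the SUM of the one-prime Rayleigh quotients -/

/-- **Norm of the product comb:** `‖g‖₂² = ‖h‖₂²·Π_{p∈T} Σ_i X_p(i)²` (teeth pairwise `2δ`-separated: the `e = 0` case of the separation). -/
theorem integral_norm_sq_prodComb (hh : IsWeilTest h) (hsupp : tsupport h ⊆ Icc (-δ) δ) (hT : ∀ p ∈ T, p.Prime)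
    (hx : ∀ k, x k = ∑ p : T, (k p : ℝ) * Real.log (p : ℕ) - C) (ha : ∀ k, a k = ((∏ p : T, X p (k p) : ℝ) : ℂ))
    (hsep0 : ∀ k ∈ Fintype.piFinset (fun p : T ↦ Finset.range (m p + 1)), ∀ k' ∈ Fintype.piFinset (fun p : T ↦ Finset.range (m p + 1)),
      x k - x k' ≠ 0 → 2 * δ < |x k - x k'|) :
    ∫ u : ℝ, ‖∑ k ∈ Fintype.piFinset (fun p : T ↦ Finset.range (m p + 1)), a k * h (u - x k)‖ ^ 2 =
      (∫ u : ℝ, ‖h u‖ ^ 2) * ∏ p : T, ∑ i ∈ Finset.range (m p + 1), X p i ^ 2 := by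
  classical
  have hinj : ∀ k k' : T → ℕ, x k = x k' → k = k' := by
    intro k k' hkk'
    rcases isEmpty_or_nonempty T with hT' | ⟨⟨p₀⟩⟩
    · exact funext fun p ↦ (hT'.false p).elim
    · have := eq_update_of_sum_log_eq hT k k' p₀ 0 (by rw [hx, hx] at hkk'; push_cast; linarith)
      rw [this, add_zero, Function.update_eq_self]
  rw [integral_norm_sq_comb hh hsupp fun k hk k' hk' hne ↦ hsep0 k hk k' hk' (fun h0 ↦ hne (hinj k k' (by linarith)))]
  congr 1
  rw [Finset.prod_univ_sum]
  refine Finset.sum_congr rfl fun k _ ↦ ?_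
  rw [ha, Complex.norm_real, Real.norm_eq_abs, sq_abs, ← Finset.prod_pow]

variable {P : (ℝ → ℂ) → Prop}

/-- **★ THE JOINT COST OF THE PRODUCT COMB IS THE SUM OF THE ONE-PRIME RAYLEIGH QUOTIENTS:**
`λ_min(S∖T; C+δ)·‖h‖₂²·Π_p|X_p|² ≤ Re Q_S(g) + ‖h‖₂²·Σ_{p₀∈T} [2Σ_{d<E} w_{p₀,d+1} Σ_i X_{p₀}(i+d+1)X_{p₀}(i)]·Π_{p≠p₀}|X_p|²`, i.e. after
dividing by `‖g‖₂² = ‖h‖₂²Π|X_p|²`: joint floor ≤ comb energy per unit norm + Σ_p `X_pᵀA_{m_p}(p)X_p/|X_p|²` (= `−Σ_p F̌_p(m_p)` for the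
band-edge combs): joint floors are asymptotically ADDITIVE; the floor-level interaction is at most the sum of the band-edge gaps. -/
theorem semilocalGroundEnergy_sdiff_mul_le_prodComb (hh : IsWeilTest h) (hsupp : tsupport h ⊆ Icc (-δ) δ)
    (hT : ∀ p ∈ T, p.Prime) (hx : ∀ k, x k = ∑ p : T, (k p : ℝ) * Real.log (p : ℕ) - C)
    (hC : C = (∑ p : T, (m p : ℝ) * Real.log (p : ℕ)) / 2) (ha : ∀ k, a k = ((∏ p : T, X p (k p) : ℝ) : ℂ))
    (hX : ∀ p ∈ T, ∀ i, m p < i → X p i = 0) {E : ℕ} (hE : ∀ p : T, 2 * (C + δ) < (E + 1) * Real.log (p : ℕ))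
    (hsep : ∀ k ∈ Fintype.piFinset (fun p : T ↦ Finset.range (m p + 1)), ∀ k' ∈ Fintype.piFinset (fun p : T ↦ Finset.range (m p + 1)),
      ∀ p₀ : T, ∀ e ≤ E, x k - x k' ≠ e * Real.log (p₀ : ℕ) → 2 * δ < |x k - x k' - e * Real.log (p₀ : ℕ)|)
    (hsep0 : ∀ k ∈ Fintype.piFinset (fun p : T ↦ Finset.range (m p + 1)), ∀ k' ∈ Fintype.piFinset (fun p : T ↦ Finset.range (m p + 1)),
      x k - x k' ≠ 0 → 2 * δ < |x k - x k'|)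
    {S : Finset ℕ} (hTS : T ⊆ S) :
    semilocalGroundEnergy (S \ T) (fun _ ↦ True) (C + δ) * ((∫ u : ℝ, ‖h u‖ ^ 2) * ∏ p : T, ∑ i ∈ Finset.range (m p + 1), X p i ^ 2) ≤
      (weilSemilocalQuadratic S (fun t ↦ ∑ k ∈ Fintype.piFinset (fun p : T ↦ Finset.range (m p + 1)), a k * h (t - x k))).re +
        (∫ u : ℝ, ‖h u‖ ^ 2) * ∑ p₀ : T,
          ((2 * ∑ d ∈ Finset.range E, Real.log (p₀ : ℕ) / Real.sqrt (((p₀ : ℕ) : ℝ) ^ (d + 1)) *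
              ∑ i ∈ Finset.range (m p₀ + 1), X p₀ (i + (d + 1)) * X p₀ i) *
            ∏ p ∈ Finset.univ.erase p₀, ∑ i ∈ Finset.range (m p + 1), X p i ^ 2) := by
  have hg := isWeilTest_comb hh (Fintype.piFinset (fun p : T ↦ Finset.range (m p + 1))) x a
  have hxC : ∀ k ∈ Fintype.piFinset (fun p : T ↦ Finset.range (m p + 1)), x k ∈ Icc (-(C + δ - δ)) (C + δ - δ) := by
    intro k hk
    have := sum_mul_log_mem_Icc hT hk
    rw [hx k, mem_Icc] at *
    constructor <;> linarith [this.1, this.2]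
  have hgs := tsupport_comb_subset (a := a) hsupp hxC
  have h1 := semilocalGroundEnergy_mul_le_re (S := S \ T) (P := fun _ ↦ True) hg hgs (fun _ _ ↦ trivial)
  rw [integral_norm_sq_prodComb hh hsupp hT hx ha hsep0] at h1
  have h2 := congrArg Complex.re (weilSemilocalQuadratic_sdiff_sub_prodComb hh hsupp hT hx hC ha hX hE hsep hTS)
  rw [Complex.sub_re, Complex.ofReal_re] at h2
  linarith

end Summit.RiemannHypothesis.RiemannHypothesis.Theorems.SemilocalDeletionProductCombs

end
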